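import Literature.RingTheory.Nullstellensatz.EffectiveNullstellensatz
import Literature.RingTheory.Nullstellensatz.PerronSharpDegreeBoundProofs
import Mathlib.RingTheory.AlgebraicIndependent.Transcendental
import HarnessLib

/-!
# The effective Nullstellensatz with the sharp Perron constant: `deg g_i ≤ (d+1)^{n+2}`

Topic `Literature/RingTheory/Nullstellensatz`.  Z. Jelonek, *On the effective Nullstellensatz*,
Invent. Math. 162 (2005), Thm. 1.1, proves `1 = ∑ g_i f_i` with `deg g_i f_i` of `d^n`-type for
`f_1, …, f_s ∈ K[x_1, …, x_n]` of degree `≤ d` without common zero, by an elementary argument whose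
engine is Perron's theorem on the degree of an algebraic relation.  The sibling file
`EffectiveNullstellensatz` carries Jelonek's argument out with the WEAK Perron theorem
(`PerronTheorem`, a bare dimension count) and gets
`deg g_i ≤ effNSBound n d = (d+1)(n+2)(2(d+1)(n+2))^{n+1}`.  Now that the SHARP (weighted) Perron
theorem is proved in the tree (`PerronSharp.exists_algRelation_weighted`,
`PerronSharpDegreeBoundProofs`: `deg_w P ≤ ∏ δ_j`), the very same argument gives

**`exists_sum_mul_eq_one_sharp`: `1 = ∑ g_i f_i` with `deg g_i ≤ (d+1)^{n+2}`**

(single-exponential WITHOUT the `n^n` factor; Jelonek's own constant is finer still — he exploits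
the weights, we only use the resulting total-degree bound `deg P ≤ ∏ deg = 1 · (d+1)^{n+1}` for the
relation among `Z, L_0, …, L_n`, where `Z` has degree `1` and the `n+1` Noether coordinates `L_j`
degree `≤ d+1`; the extraction step multiplies by `d+1`).  The proof is the sibling file's, verbatim
except for Step 3 (sharp Perron instead of the dimension count, plus «an algebraically independent
element is non-constant» for the hypothesis `deg ≥ 1`) and the final arithmetic; all the machinery
(`idealUpTo`, `GoodCoeffs`, `linSubst`, `goodCoeffs_aeval_linSubst`, linear Noether
normalisation) is imported from it.  Coefficients in any infinite field `k`, zeros in an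
algebraically closed `K ⊇ k`, as there.  Consumers of `effNSBound` are untouched.

## References
* Z. Jelonek, *On the effective Nullstellensatz*, Invent. Math. 162 (2005), 1–17, Thm. 1.1 and
  its proof. [Jelonek2005]
* A. Płoski, *Algebraic dependence of polynomials after O. Perron and some applications* (2005),
  Thm. 1.1 (Perron's theorem, weighted form). [Ploski2005]
-/

noncomputable section

open MvPolynomial

namespace Literature.RingTheory.Nullstellensatz

section Main

variable {k : Type*} [Field k] [Infinite k] {K : Type*} [Field K] [Algebra k K] [IsAlgClosed K]

/-- **Effective Nullstellensatz, sharp-Perron constant** (after Z. Jelonek, *On the effective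
Nullstellensatz*, Invent. Math. 162 (2005), Thm. 1.1; here with the constant `(d+1)^{n+2}`, weaker
than Jelonek's `d^n`-type bound, stronger than the sibling `effNSBound n d`). Let `k` be an
infinite field, `K ⊇ k` algebraically closed, and `f_1, …, f_s ∈ k[X_1, …, X_n]` of degree `≤ d`
without common zero in `Kⁿ`. Then `1 = ∑ g_i f_i` with `deg g_i ≤ (d+1)^{n+2}`.
Proof: Jelonek's method exactly as in `exists_sum_mul_eq_one_of_forall_exists_ne_zero`, with the
sharp Perron theorem (`PerronSharp.exists_algRelation_weighted`) bounding the relation of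
`(Z, L_0, …, L_n)` by `∏ deg = (d+1)^{n+1}`. [cite: Jelonek2005, Thm. 1.1 (weaker constant)] -/
theorem exists_sum_mul_eq_one_sharp {n s d : ℕ}
    (f : Fin s → MvPolynomial (Fin n) k) (hd : ∀ i, (f i).totalDegree ≤ d)
    (hV : ∀ x : Fin n → K, ∃ i, aeval x (f i) ≠ 0) :
    ∃ g : Fin s → MvPolynomial (Fin n) k, ∑ i, g i * f i = 1 ∧
      ∀ i, (g i).totalDegree ≤ (d + 1) ^ (n + 2) := by
  classical
  -- Step 0: the classical Nullstellensatz
  obtain ⟨a, ha⟩ : ∃ a : Fin s → MvPolynomial (Fin n) k, ∑ i, a i * f i = 1 := by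
    set I : Ideal (MvPolynomial (Fin n) k) := Ideal.span (Set.range f) with hI
    have hZ : MvPolynomial.zeroLocus K I = ∅ := by
      refine Set.eq_empty_iff_forall_notMem.2 fun x hx => ?_
      obtain ⟨i, hi⟩ := hV x
      exact hi ((MvPolynomial.mem_zeroLocus_iff.1 hx) (f i) (Ideal.subset_span ⟨i, rfl⟩))
    have hrad := MvPolynomial.vanishingIdeal_zeroLocus_eq_radical (K := K) I
    rw [hZ, MvPolynomial.vanishingIdeal_empty, eq_comm, Ideal.radical_eq_top] at hrad
    have h1 : (1 : MvPolynomial (Fin n) k) ∈ I := hrad ▸ Submodule.mem_top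
    exact Ideal.mem_span_range_iff_exists_fun.1 h1
  -- `s ≥ 1`
  have hs : 1 ≤ s := by
    rcases Nat.eq_zero_or_pos s with h0 | h0
    · subst h0; obtain ⟨i, -⟩ := hV 0; exact i.elim0
    · exact h0
  -- Step 1: the ring `R = k[X_0, X_1, …, X_n]` (`X_0` playing `Z`) and the generators
  set z : MvPolynomial (Fin (n + 1)) k := X 0 with hz0
  set u : Fin s → MvPolynomial (Fin (n + 1)) k := fun i => z * rename Fin.succ (f i) with hu
  set v : Fin n → MvPolynomial (Fin (n + 1)) k := fun j => X j.succ with hv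
  set y : Fin (s + n) → MvPolynomial (Fin (n + 1)) k := Fin.append u v with hy
  have hyu : ∀ i, u i ∈ Set.range y := fun i => ⟨Fin.castAdd n i, by rw [hy, Fin.append_left]⟩
  have hyv : ∀ j, v j ∈ Set.range y := fun j => ⟨Fin.natAdd s j, by rw [hy, Fin.append_right]⟩
  -- `k[y] = R`
  have hX0 : z ∈ Algebra.adjoin k (Set.range y) := by
    have h1 : z = ∑ i, rename Fin.succ (a i) * u i := by
      have := congrArg (rename (Fin.succ : Fin n → Fin (n + 1))) ha
      rw [map_sum, map_one] at this
      calc z = z * 1 := (mul_one z).symm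
        _ = z * ∑ i, rename Fin.succ (a i * f i) := by rw [this]
        _ = ∑ i, rename Fin.succ (a i) * u i := by
            rw [Finset.mul_sum]
            exact Finset.sum_congr rfl fun i _ => by simp only [map_mul, hu]; ring
    rw [h1]
    refine Subalgebra.sum_mem _ fun i _ => Subalgebra.mul_mem _ ?_ (Algebra.subset_adjoin (hyu i))
    have hsub : Set.range (fun j : Fin n => (X j.succ : MvPolynomial (Fin (n + 1)) k)) ⊆
        Set.range y := by
      rintro _ ⟨j, rfl⟩; exact hyv j
    refine Algebra.adjoin_mono hsub ?_
    have hren : (rename Fin.succ : MvPolynomial (Fin n) k →ₐ[k] MvPolynomial (Fin (n + 1)) k) =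
        aeval (fun j : Fin n => (X j.succ : MvPolynomial (Fin (n + 1)) k)) :=
      MvPolynomial.algHom_ext fun j => by simp
    rw [hren, Algebra.adjoin_range_eq_range_aeval]
    exact AlgHom.mem_range_self _ _
  have htop : Algebra.adjoin k (Set.range y) = ⊤ := by
    rw [eq_top_iff, ← MvPolynomial.adjoin_range_X, Algebra.adjoin_le_iff]
    rintro _ ⟨m, rfl⟩
    refine Fin.cases hX0 (fun j => Algebra.subset_adjoin (hyv j)) m
  have hint : ∀ b : MvPolynomial (Fin (n + 1)) k, IsIntegral (Algebra.adjoin k (Set.range y)) b :=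
    fun b => Literature.RingTheory.NoetherNormalization.isIntegral_of_mem_subalgebra
      (by rw [htop]; exact Algebra.mem_top)
  -- degrees: every element of `span_k y` has degree `≤ d + 1`
  have hudeg : ∀ i, (u i).totalDegree ≤ d + 1 := fun i => by
    rw [hu]
    refine (totalDegree_mul _ _).trans ?_
    rw [add_comm]
    exact add_le_add ((totalDegree_rename_le _ _).trans (hd i)) (by rw [hz0, totalDegree_X])
  have hvdeg : ∀ j, (v j).totalDegree ≤ d + 1 := fun j => by
    rw [hv]
    change (X j.succ : MvPolynomial (Fin (n + 1)) k).totalDegree ≤ d + 1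
    rw [totalDegree_X]; omega
  have hydeg : ∀ m, (y m).totalDegree ≤ d + 1 := by
    intro m
    refine Fin.addCases (fun i => ?_) (fun j => ?_) m
    · rw [hy, Fin.append_left]; exact hudeg i
    · rw [hy, Fin.append_right]; exact hvdeg j
  have hspan_deg : ∀ w ∈ Submodule.span k (Set.range y),
      (w : MvPolynomial (Fin (n + 1)) k).totalDegree ≤ d + 1 := by
    intro w hw
    have hle : Submodule.span k (Set.range y) ≤ restrictTotalDegree (Fin (n + 1)) k (d + 1) :=
      Submodule.span_le.2 (by rintro _ ⟨m, rfl⟩; exact (mem_restrictTotalDegree _ _ _).2 (hydeg m))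
    exact (mem_restrictTotalDegree _ _ _).1 (hle hw)
  -- Step 2: linear Noether normalisation, `n + 1` independent linear combinations `L`
  obtain ⟨L, hLspan, hLint⟩ :=
    Literature.RingTheory.NoetherNormalization.exists_linear_noether_normalization (k := k)
      (A := MvPolynomial (Fin (n + 1)) k) (n + 1) (s + n) y (by omega) hint
      (fun w _ => exists_relation_of_card_eq_succ w)
  set S : Subalgebra k (MvPolynomial (Fin (n + 1)) k) := Algebra.adjoin k (Set.range L) with hS
  haveI hIntS : Algebra.IsIntegral S (MvPolynomial (Fin (n + 1)) k) := ⟨hLint⟩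
  have hTB : IsTranscendenceBasis k L :=
    Algebra.IsAlgebraic.isTranscendenceBasis_of_lift_le_trdeg_of_finite k L (by
      simp only [MvPolynomial.trdeg_of_isDomain, Cardinal.mk_fin, Cardinal.lift_natCast, le_refl])
  have hL : AlgebraicIndependent k L := hTB.1
  -- Step 3: SHARP Perron (weighted form) for `(Z, L_0, …, L_n)`: `deg P ≤ 1 · (d+1)^{n+1}`
  set Q : Fin (n + 2) → MvPolynomial (Fin (n + 1)) k := Fin.cons z L with hQ
  have hQz : (Q 0).totalDegree = 1 := by
    change z.totalDegree = 1
    rw [hz0, totalDegree_X]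
  have hQdeg : ∀ t : Fin (n + 1), (Q t.succ).totalDegree ≤ d + 1 := fun t => by
    change (L t).totalDegree ≤ d + 1
    exact hspan_deg _ (hLspan t)
  have hQpos : ∀ i, 0 < (Q i).totalDegree := by
    intro i
    refine Fin.cases ?_ (fun t => ?_) i
    · rw [hQz]; exact Nat.one_pos
    · change 0 < (L t).totalDegree
      by_contra h0
      have hC : L t = C ((L t).coeff 0) := totalDegree_eq_zero_iff_eq_C.1 (by omega)
      exact hL.transcendental t (by rw [hC]; exact isAlgebraic_algebraMap _)
  obtain ⟨P, hP0, hPQ, hPwt⟩ := PerronSharp.exists_algRelation_weighted Q hQpos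
  set B := (d + 1) ^ (n + 1) with hB
  have hprod : ∏ i, (Q i).totalDegree ≤ B := by
    rw [Fin.prod_univ_succ, hQz, one_mul, hB]
    have h1 : ((d + 1) ^ (n + 1) : ℕ) = ∏ _t : Fin (n + 1), (d + 1) := by
      rw [Finset.prod_const, Finset.card_univ, Fintype.card_fin]
    rw [h1]
    exact Finset.prod_le_prod' fun t _ => hQdeg t
  have hPdeg : P.totalDegree ≤ B := by
    rw [totalDegree, Finset.sup_le_iff]
    intro e he
    refine le_trans ?_ ((hPwt e he).trans hprod)
    rw [Finsupp.weight_apply, Finsupp.sum]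
    exact Finset.sum_le_sum fun i _ => by
      simpa using Nat.le_mul_of_pos_right (e i) (hQpos i)
  -- Step 4: the minimal polynomial of `Z` over `k[L] ≅ k[T_0, …, T_n]`
  set φ : MvPolynomial (Fin (n + 1)) k ≃ₐ[k] S := hL.aevalEquiv with hφ
  haveI : UniqueFactorizationMonoid S :=
    (φ.toMulEquiv).uniqueFactorizationMonoid inferInstance
  have hzint : IsIntegral S z := hLint z
  set μ := minpoly S z with hμ
  -- `P`, as a polynomial in its first variable with coefficients transported to `S`
  set P' : Polynomial S :=
    (finSuccEquiv k (n + 1) P).map (φ : MvPolynomial (Fin (n + 1)) k →+* S) with hP'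
  have hcompφ : (algebraMap S (MvPolynomial (Fin (n + 1)) k)).comp
      (φ : MvPolynomial (Fin (n + 1)) k →+* S) =
      (aeval L : MvPolynomial (Fin (n + 1)) k →ₐ[k] MvPolynomial (Fin (n + 1)) k).toRingHom :=
    RingHom.ext fun p => hL.algebraMap_aevalEquiv p
  have hP'z : Polynomial.aeval z P' = 0 := by
    rw [Polynomial.aeval_def, hP', Polynomial.eval₂_map, hcompφ]
    change Polynomial.aevalTower
      (aeval L : MvPolynomial (Fin (n + 1)) k →ₐ[k] MvPolynomial (Fin (n + 1)) k) z
      (finSuccEquiv k (n + 1) P) = 0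
    rw [← Literature.RingTheory.NoetherNormalization.aeval_finCons_eq_aevalTower_finSuccEquiv]
    exact hPQ
  have hdvd : μ ∣ P' := minpoly.isIntegrallyClosed_dvd hzint hP'z
  -- back in `k[T_0, …, T_{n+1}]`
  set μ₀ : Polynomial (MvPolynomial (Fin (n + 1)) k) :=
    μ.map (φ.symm : S →+* MvPolynomial (Fin (n + 1)) k) with hμ₀
  have hsymmφ : (φ.symm : S →+* MvPolynomial (Fin (n + 1)) k).comp
      (φ : MvPolynomial (Fin (n + 1)) k →+* S) = RingHom.id _ :=
    RingHom.ext fun p => φ.symm_apply_apply p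
  have hφsymm : (φ : MvPolynomial (Fin (n + 1)) k →+* S).comp
      (φ.symm : S →+* MvPolynomial (Fin (n + 1)) k) = RingHom.id _ :=
    RingHom.ext fun p => φ.apply_symm_apply p
  have hμ₀μ : μ₀.map (φ : MvPolynomial (Fin (n + 1)) k →+* S) = μ := by
    rw [hμ₀, Polynomial.map_map, hφsymm, Polynomial.map_id]
  have hdvd₀ : μ₀ ∣ finSuccEquiv k (n + 1) P := by
    have h := Polynomial.map_dvd (φ.symm : S →+* MvPolynomial (Fin (n + 1)) k) hdvd
    rwa [hP', Polynomial.map_map, hsymmφ, Polynomial.map_id] at h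
  set G : MvPolynomial (Fin (n + 2)) k := (finSuccEquiv k (n + 1)).symm μ₀ with hG
  have hGμ₀ : finSuccEquiv k (n + 1) G = μ₀ := (finSuccEquiv k (n + 1)).apply_symm_apply μ₀
  have hGdvd : G ∣ P := by
    obtain ⟨q, hq⟩ := hdvd₀
    refine ⟨(finSuccEquiv k (n + 1)).symm q, ?_⟩
    apply (finSuccEquiv k (n + 1)).injective
    rw [map_mul, hGμ₀, (finSuccEquiv k (n + 1)).apply_symm_apply, hq]
  have hGdeg : G.totalDegree ≤ B := (totalDegree_le_of_dvd_of_isDomain hGdvd hP0).trans hPdeg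
  have hcoeff_deg : ∀ j, (μ₀.coeff j).totalDegree ≤ B := by
    intro j
    by_cases h0 : μ₀.coeff j = 0
    · rw [h0, totalDegree_zero]; exact Nat.zero_le _
    · rw [← hGμ₀] at h0 ⊢
      exact le_trans (Nat.le_add_right _ _)
        ((totalDegree_coeff_finSuccEquiv_add_le G j h0).trans hGdeg)
  -- `μ₀` is monic of positive degree `M`
  have hμm : μ.Monic := minpoly.monic hzint
  have hμ₀m : μ₀.Monic := hμm.map _
  set M := μ₀.natDegree with hM
  have hM1 : 1 ≤ M := by
    rw [hM, hμ₀, (minpoly.monic hzint).natDegree_map]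
    exact minpoly.natDegree_pos hzint
  -- the identity `∑_j (aeval L (μ₀ⱼ)) z^j = 0` in `R`
  have hident : ∑ j ∈ Finset.range (M + 1), aeval L (μ₀.coeff j) * z ^ j = 0 := by
    have h := minpoly.aeval S z
    rw [← hμ, ← hμ₀μ, Polynomial.aeval_def, Polynomial.eval₂_map, hcompφ,
      Polynomial.eval₂_eq_sum_range] at h
    exact h
  -- Step 5: pass to `A[Z]`, `A = k[X_1, …, X_n]`, through `Φ = finSuccEquiv k n`
  have hΦu : ∀ (i : Fin s) (c : k), finSuccEquiv k n (c • u i) =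
      Polynomial.X * Polynomial.C (c • f i) := by
    intro i c
    rw [map_smul, hu]
    change c • finSuccEquiv k n (z * rename Fin.succ (f i)) = _
    rw [map_mul, hz0, finSuccEquiv_X_zero, finSuccEquiv_rename_succ, ← Polynomial.smul_C,
      mul_smul_comm]
  have hΦv : ∀ (j : Fin n) (c : k), finSuccEquiv k n (c • v j) = Polynomial.C (c • X j) := by
    intro j c
    rw [map_smul, hv]
    change c • finSuccEquiv k n (X j.succ) = _
    rw [finSuccEquiv_X_succ, Polynomial.smul_C]
  -- the linear decomposition of the `L_t`
  have hdecomp : ∀ t, ∃ lam ψ : MvPolynomial (Fin n) k, lam.totalDegree ≤ 1 ∧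
      ψ ∈ Submodule.span k (Set.range f) ∧ ψ.totalDegree ≤ d ∧
      finSuccEquiv k n (L t) = Polynomial.C lam + Polynomial.X * Polynomial.C ψ := by
    intro t
    obtain ⟨c, hc⟩ := (Submodule.mem_span_range_iff_exists_fun k).1 (hLspan t)
    refine ⟨∑ j, c (Fin.natAdd s j) • X j, ∑ i, c (Fin.castAdd n i) • f i, ?_, ?_, ?_, ?_⟩
    · refine (mem_restrictTotalDegree _ _ _).1 (Submodule.sum_mem _ fun j _ =>
        Submodule.smul_mem _ _ ((mem_restrictTotalDegree _ _ _).2 ?_))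
      rw [totalDegree_X]
    · exact Submodule.sum_mem _ fun i _ => Submodule.smul_mem _ _ (Submodule.subset_span ⟨i, rfl⟩)
    · exact (mem_restrictTotalDegree _ _ _).1 (Submodule.sum_mem _ fun i _ =>
        Submodule.smul_mem _ _ ((mem_restrictTotalDegree _ _ _).2 (hd i)))
    · rw [← hc, Fin.sum_univ_add, map_add, map_sum, map_sum]
      have h1 : ∀ i, finSuccEquiv k n (c (Fin.castAdd n i) • y (Fin.castAdd n i)) =
          Polynomial.X * Polynomial.C (c (Fin.castAdd n i) • f i) := fun i => by
        rw [hy, Fin.append_left]; exact hΦu i _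
      have h2 : ∀ j, finSuccEquiv k n (c (Fin.natAdd s j) • y (Fin.natAdd s j)) =
          Polynomial.C (c (Fin.natAdd s j) • X j) := fun j => by
        rw [hy, Fin.append_right]; exact hΦv j _
      simp only [h1, h2]
      rw [← Finset.mul_sum, ← map_sum, ← map_sum, add_comm]
  choose lam ψ hlam hψ hψd hΦL using hdecomp
  have hΦL' : (fun t => finSuccEquiv k n (L t)) = linSubst lam ψ := funext fun t => hΦL t
  -- apply `Φ` to the identity
  have hident' : ∑ j ∈ Finset.range (M + 1),
      aeval (linSubst lam ψ) (μ₀.coeff j) * Polynomial.X ^ j =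
        (0 : Polynomial (MvPolynomial (Fin n) k)) := by
    have h := congrArg (finSuccEquiv k n) hident
    rw [map_sum, map_zero] at h
    rw [← h]
    refine Finset.sum_congr rfl fun j _ => ?_
    rw [map_mul, map_pow]
    congr 1
    · rw [← hΦL']
      change _ = ((finSuccEquiv k n).toAlgHom.comp (aeval L)) (μ₀.coeff j)
      rw [MvPolynomial.comp_aeval]
      rfl
    · rw [hz0, finSuccEquiv_X_zero]
  -- the coefficient of `Z^M`
  have hgood : ∀ j, GoodCoeffs f d (aeval (linSubst lam ψ) (μ₀.coeff j)) B := fun j =>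
    goodCoeffs_aeval_linSubst hlam hψ hψd (hcoeff_deg j)
  have hcoefM := congrArg (fun T : Polynomial (MvPolynomial (Fin n) k) => T.coeff M) hident'
  simp only [Polynomial.finsetSum_coeff, Polynomial.coeff_mul_X_pow', Polynomial.coeff_zero]
    at hcoefM
  rw [Finset.sum_range_succ, if_pos le_rfl, Nat.sub_self] at hcoefM
  have hlead : (aeval (linSubst lam ψ) (μ₀.coeff M)).coeff 0 = 1 := by
    have : μ₀.coeff M = 1 := hμ₀m.coeff_natDegree
    rw [this, map_one, Polynomial.coeff_one_zero]
  rw [hlead] at hcoefM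
  -- the remaining terms lie in `(f)_{≤ B(d+1)}`
  have hrest : ∑ j ∈ Finset.range M, (if j ≤ M then
      (aeval (linSubst lam ψ) (μ₀.coeff j)).coeff (M - j) else 0) ∈ idealUpTo f (B * (d + 1)) := by
    refine Submodule.sum_mem _ fun j hj => ?_
    rw [Finset.mem_range] at hj
    rw [if_pos hj.le]
    exact (hgood j).1 (M - j) (by omega)
  have hone : (1 : MvPolynomial (Fin n) k) ∈ idealUpTo f (B * (d + 1)) := by
    have h1 : (1 : MvPolynomial (Fin n) k) = -(∑ j ∈ Finset.range M, (if j ≤ M then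
        (aeval (linSubst lam ψ) (μ₀.coeff j)).coeff (M - j) else 0)) := by
      linear_combination hcoefM
    rw [h1]
    exact Submodule.neg_mem _ hrest
  obtain ⟨g, hg, hg1⟩ := mem_idealUpTo_iff.1 hone
  exact ⟨g, hg1, fun i => (hg i).trans (by rw [hB, ← pow_succ])⟩


end Main

end Literature.RingTheory.Nullstellensatz

end
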